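import Literature.Analysis.FunctionSpaces.PolchinskiLogSobolev
import Mathlib.Analysis.Calculus.Gradient.Basic
import Mathlib.Analysis.Calculus.FDeriv.Pow
import HarnessLib

/-!
# The multiscale Bakry–Émery criterion in log-Sobolev form: `Ent_{ν₀}(f²) ≤ 2(∫₀^∞e^{−2λ_t}dt)·E_{ν₀}[⟨∇f, Ċ₀∇f⟩]`
# for `f ∈ C_c^∞(ℝ^N)` and `V₀ ∈ C_b⁴` (Bauerschmidt–Bodineau–Dagallier, Theorem 3, (e:LSI))

Topic `Literature/Analysis/FunctionSpaces`; companion of `PolchinskiLogSobolev.lean`.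

[BBD] state Theorem 3 as `Ent_{ν₀}(F) ≤ (2/γ)E_{ν₀}[(∇√F)²_{Ċ₀}]` for `F ≥ 0` «in a compact interval `I ⊂ (0,∞)`»
(p0016 L43); the usual log-Sobolev form for `F = f²`, `(∇√F)²_{Ċ₀} = (∇f)²_{Ċ₀}`, follows by applying the
theorem to `F = f² + ε` and letting `ε ↓ 0` (`Ċ₀ ≥ 0` gives `(∇(f²+ε))²_{Ċ₀}/(4(f²+ε)) ≤ (∇f)²_{Ċ₀}`;
dominated convergence on the entropy side).  This file carries out that routine passage from
`entropy_le_of_multiscaleBakryEmery`, producing the inequality in exactly the shape of the tree's named fact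
`BauerschmidtBodineau_multiscaleBakryEmery` (entropy of `f²` under `Polchinski.nu0`, right-hand side
`⟪gradient f, toEuclideanLin (Ċ 0) (gradient f)⟫`) — for the hypotheses class `V₀ ∈ C⁴` with bounded
derivatives and `f ∈ C^∞` with compact support (the named fact itself is typed for measurable `V₀` and
`f ∈ C¹_c` and is NOT discharged here).

## Main result (sorry-free; no new definitions, no new named facts)

* **`logSobolev_of_multiscaleBakryEmery`** — (e:LSI) of [BBD] Theorem 3 for `f ∈ C_c^∞`, `V₀ ∈ C_b⁴`.

No claim about Yang–Mills is made (no gauge instance of (e:assCt-mon) exists in print; the Clay problem is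
untouched; in this programme the criterion bears only on the conditional rung `BalabanLadder.UV`).

## References

* [BauerschmidtBodineauDagallier2023] R. Bauerschmidt, T. Bodineau, B. Dagallier, Probab. Surveys 21
  (2024) 200–290, arXiv:2307.07619 — Theorem 3 p0015 L62–90 ((e:LSI)), p0016 L40–45. READ (held text).
-/

noncomputable section

set_option maxSynthPendingDepth 3

open MeasureTheory ProbabilityTheory Filter Topology Set
open scoped RealInnerProductSpace Matrix MatrixOrder ContDiff Gradient

namespace Literature.Analysis.FunctionSpaces

namespace Polchinski

variable {N : ℕ}

section Helpers

/-- `⟪v, Ċ v⟫ = Σ_{kl} Ċ_{kl} v_k v_l` on `EuclideanSpace`. [folklore] -/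
private theorem inner_toEuclideanLin_self (C : Matrix (Fin N) (Fin N) ℝ) (v : EuclideanSpace ℝ (Fin N)) :
    ⟪v, Matrix.toEuclideanLin C v⟫ = ∑ k, ∑ l, C k l * (v k * v l) := by
  rw [EuclideanSpace.inner_eq_star_dotProduct, star_trivial]
  show (C *ᵥ WithLp.ofLp v) ⬝ᵥ WithLp.ofLp v = _
  simp only [dotProduct, Matrix.mulVec, Finset.sum_mul]
  exact Finset.sum_congr rfl fun k _ => Finset.sum_congr rfl fun l _ => by ring

/-- Coordinates of the gradient: `(∇f)_k = ∂_k f`. [folklore] -/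
private theorem gradient_apply_single (f : EuclideanSpace ℝ (Fin N) → ℝ) (φ : EuclideanSpace ℝ (Fin N))
    (k : Fin N) : (gradient f φ) k = fderiv ℝ f φ (EuclideanSpace.single k 1) := by
  have h := EuclideanSpace.inner_single_right k (1 : ℝ) (gradient f φ)
  simp only [one_mul, RCLike.conj_to_real] at h
  rw [← h, inner_gradient_left]

/-- A smooth compactly supported function has bounded derivatives of orders `≤ 4`. [folklore] -/
private theorem exists_bound_iteratedFDeriv {g : EuclideanSpace ℝ (Fin N) → ℝ} (hg : ContDiff ℝ ∞ g)
    (hgc : HasCompactSupport g) : ∃ B, ∀ n ≤ 4, ∀ x, ‖iteratedFDeriv ℝ n g x‖ ≤ B := by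
  have hb : ∀ n : ℕ, ∃ B, ∀ x, ‖iteratedFDeriv ℝ n g x‖ ≤ B := fun n =>
    (contDiff_infty.1 hg n).continuous_iteratedFDeriv'.bounded_above_of_compact_support
      (hgc.iteratedFDeriv n)
  choose B hB using hb
  refine ⟨∑ n ∈ Finset.range 5, |B n|, fun n hn x => (hB n x).trans ((le_abs_self _).trans
    (Finset.single_le_sum (f := fun n => |B n|) (fun _ _ => abs_nonneg _)
      (Finset.mem_range.2 (by omega))))⟩

end Helpers

section Main

variable (D : CovDecomposition N) {V₀ : EuclideanSpace ℝ (Fin N) → ℝ} {BV : ℝ}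

set_option maxHeartbeats 800000 in
/-- **[BBD] Theorem 3 in log-Sobolev form (e:LSI), proved for `V₀ ∈ C_b⁴` and `f ∈ C_c^∞`.**  Under the
hypotheses of `entropy_le_of_multiscaleBakryEmery` on `(C_t)`, `V₀`, (e:continuity), (e:assCt-mon), `λ`:
for every smooth compactly supported `f : ℝ^N → ℝ`,
`E_{ν₀}[f² log f²] − E_{ν₀}[f²] log E_{ν₀}[f²] ≤ 2(∫₀^∞ e^{−2λ_t}dt)·E_{ν₀}[⟨∇f, Ċ_0 ∇f⟩]`
(from the theorem for `F = f² + ε`, `Ċ_0 ≥ 0`, `ε ↓ 0`).  Same shape as the named fact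
`BauerschmidtBodineau_multiscaleBakryEmery` but for this regularity class only; not a discharge of it; no
Yang–Mills content. [cite: BauerschmidtBodineauDagallier2023, Theorem 3] -/
theorem logSobolev_of_multiscaleBakryEmery
    (hV : ContDiff ℝ 4 V₀) (hVB : ∀ n ≤ 4, ∀ x, ‖iteratedFDeriv ℝ n V₀ x‖ ≤ BV)
    (hCA : ContinuityAssumption D V₀) {lamdot lam : ℝ → ℝ} (hMS : MultiscaleCondition D V₀ lamdot)
    (hli : ∀ t, 0 ≤ t → IntervalIntegrable lamdot volume 0 t)
    (hlam : ∀ t, 0 ≤ t → lam t = ∫ s in (0 : ℝ)..t, lamdot s)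
    (hexp : IntegrableOn (fun t => Real.exp (-2 * lam t)) (Ioi 0))
    (f : EuclideanSpace ℝ (Fin N) → ℝ) (hf : ContDiff ℝ ∞ f) (hfc : HasCompactSupport f) :
    ∫ φ, f φ ^ 2 * Real.log (f φ ^ 2) ∂(nu0 D V₀) -
        (∫ φ, f φ ^ 2 ∂(nu0 D V₀)) * Real.log (∫ φ, f φ ^ 2 ∂(nu0 D V₀)) ≤
      2 * (∫ t in Ioi (0 : ℝ), Real.exp (-2 * lam t)) *
        ∫ φ, ⟪gradient f φ, Matrix.toEuclideanLin (D.Cdot 0) (gradient f φ)⟫ ∂(nu0 D V₀) := by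
  classical
  ---------------------------------------------------------------- data
  have hVabs : ∀ x, |V₀ x| ≤ BV := Cb4.abs_le hVB
  have hb : ∀ φ, -BV ≤ V₀ φ := fun φ => (abs_le.1 (hVabs φ)).1
  have hVm : Measurable V₀ := hV.continuous.measurable
  haveI := isProbabilityMeasure_nu0 D hVm hb
  set ν := nu0 D V₀ with hν
  set I : ℝ := ∫ t in Ioi (0 : ℝ), Real.exp (-2 * lam t) with hI_def
  have hI0 : 0 ≤ I := setIntegral_nonneg measurableSet_Ioi fun t _ => (Real.exp_pos _).le
  -- bounds on `f` and its derivatives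
  obtain ⟨Bf, hBf⟩ := exists_bound_iteratedFDeriv hf hfc
  have hfabs : ∀ x, |f x| ≤ Bf := Cb4.abs_le hBf
  have hBf0 : 0 ≤ Bf := (abs_nonneg _).trans (hfabs 0)
  have hf2le : ∀ x, f x ^ 2 ≤ Bf ^ 2 := fun x => by
    rw [← sq_abs]; exact pow_le_pow_left₀ (abs_nonneg _) (hfabs x) 2
  have hf4 : ContDiff ℝ 4 f := contDiff_infty.1 hf 4
  have hfd : ∀ x, HasFDerivAt f (fderiv ℝ f x) x := Cb4.hasFDerivAt hf4
  have hdf : ∀ k x, |fderiv ℝ f x (EuclideanSpace.single k 1)| ≤ Bf := fun k x => by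
    have h := Cb4.abs_partial_le hBf (EuclideanSpace.single k 1) x
    rwa [Cb4.norm_single_one, mul_one] at h
  have hdfc : ∀ k, Continuous fun x => fderiv ℝ f x (EuclideanSpace.single k 1) := fun k =>
    (ContinuousLinearMap.apply ℝ ℝ (EuclideanSpace.single k 1)).continuous.comp
      (atom_continuous hf4 hBf).2.1
  -- the square has bounded derivatives
  have hf2 : ContDiff ℝ ∞ (fun x => f x ^ 2) := hf.pow 2
  have hf2c : HasCompactSupport (fun x => f x ^ 2) := by
    have : (fun x => f x ^ 2) = f * f := funext fun x => by simp [pow_two]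
    rw [this]
    exact hfc.mul_right
  obtain ⟨B2, hB2⟩ := exists_bound_iteratedFDeriv hf2 hf2c
  have hB20 : 0 ≤ B2 := le_trans (norm_nonneg _) (hB2 0 (by norm_num) 0)
  -- the right-hand side integrand
  have hQ : ∀ φ, ⟪gradient f φ, Matrix.toEuclideanLin (D.Cdot 0) (gradient f φ)⟫ =
      ∑ k, ∑ l, D.Cdot 0 k l * (fderiv ℝ f φ (EuclideanSpace.single k 1) *
        fderiv ℝ f φ (EuclideanSpace.single l 1)) := fun φ => by
    rw [inner_toEuclideanLin_self]
    simp only [gradient_apply_single]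
  have hQnn : ∀ φ, 0 ≤ ∑ k, ∑ l, D.Cdot 0 k l * (fderiv ℝ f φ (EuclideanSpace.single k 1) *
      fderiv ℝ f φ (EuclideanSpace.single l 1)) :=
    fun φ => sum_sum_mul_mul_self_nonneg (D.posSemidef_Cdot 0 le_rfl) _
  have hQc : Continuous fun φ => ∑ k, ∑ l, D.Cdot 0 k l * (fderiv ℝ f φ (EuclideanSpace.single k 1) *
      fderiv ℝ f φ (EuclideanSpace.single l 1)) :=
    continuous_finsetSum _ fun k _ => continuous_finsetSum _ fun l _ =>
      continuous_const.mul ((hdfc k).mul (hdfc l))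
  have hQb : ∀ φ, |∑ k, ∑ l, D.Cdot 0 k l * (fderiv ℝ f φ (EuclideanSpace.single k 1) *
      fderiv ℝ f φ (EuclideanSpace.single l 1))| ≤ ∑ k : Fin N, ∑ l : Fin N, |D.Cdot 0 k l| * (Bf * Bf) :=
    fun φ => (Finset.abs_sum_le_sum_abs _ _).trans (Finset.sum_le_sum fun k _ =>
      (Finset.abs_sum_le_sum_abs _ _).trans (Finset.sum_le_sum fun l _ => by
        rw [abs_mul, abs_mul]
        exact mul_le_mul_of_nonneg_left (mul_le_mul (hdf k φ) (hdf l φ) (abs_nonneg _) hBf0)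
          (abs_nonneg _)))
  have hQi : Integrable (fun φ => ∑ k, ∑ l, D.Cdot 0 k l * (fderiv ℝ f φ (EuclideanSpace.single k 1) *
      fderiv ℝ f φ (EuclideanSpace.single l 1))) ν :=
    Integrable.of_bound hQc.aestronglyMeasurable _ (Eventually.of_forall fun φ => by
      rw [Real.norm_eq_abs]; exact hQb φ)
  ---------------------------------------------------------------- the theorem for `F = f² + ε`
  have hstep : ∀ ε : ℝ, 0 < ε →
      ∫ φ, (f φ ^ 2 + ε) * Real.log (f φ ^ 2 + ε) ∂ν -
          (∫ φ, (f φ ^ 2 + ε) ∂ν) * Real.log (∫ φ, (f φ ^ 2 + ε) ∂ν) ≤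
        2 * I * ∫ φ, ⟪gradient f φ, Matrix.toEuclideanLin (D.Cdot 0) (gradient f φ)⟫ ∂ν := by
    intro ε hε
    have hFs : ContDiff ℝ ∞ (fun x => f x ^ 2 + ε) := hf2.add contDiff_const
    have hFB : ∀ n ≤ 4, ∀ x, ‖iteratedFDeriv ℝ n (fun x => f x ^ 2 + ε) x‖ ≤ B2 + ε := by
      intro n hn x
      rcases Nat.eq_zero_or_pos n with h0 | hpos
      · subst h0
        rw [norm_iteratedFDeriv_zero, Real.norm_eq_abs]
        have h := hB2 0 (by norm_num) x
        rw [norm_iteratedFDeriv_zero, Real.norm_eq_abs] at h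
        calc |f x ^ 2 + ε| ≤ |f x ^ 2| + |ε| := abs_add_le _ _
          _ ≤ B2 + ε := by rw [abs_of_pos hε]; linarith
      · have he : (fun x => f x ^ 2 + ε) = (fun x => f x ^ 2) + fun _ => ε := rfl
        rw [he, iteratedFDeriv_add_apply (contDiff_infty.1 hf2 n).contDiffAt contDiffAt_const,
          iteratedFDeriv_const_of_ne (Nat.pos_iff_ne_zero.1 hpos), Pi.zero_apply, add_zero]
        exact (hB2 n hn x).trans (le_add_of_nonneg_right hε.le)
    have hab : ∀ x, ε ≤ f x ^ 2 + ε ∧ f x ^ 2 + ε ≤ Bf ^ 2 + ε := fun x =>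
      ⟨le_add_of_nonneg_left (sq_nonneg _), by linarith [hf2le x]⟩
    have hmain := entropy_le_of_multiscaleBakryEmery D hV hVB hFs hFB hε hab hCA hMS hli hlam hexp
    refine hmain.trans (mul_le_mul_of_nonneg_left ?_ (by positivity))
    -- compare the integrands
    have hder : ∀ φ k, fderiv ℝ (fun x => f x ^ 2 + ε) φ (EuclideanSpace.single k 1) =
        2 * f φ * fderiv ℝ f φ (EuclideanSpace.single k 1) := fun φ k => by
      rw [(((hfd φ).pow 2).add_const ε).fderiv]
      simp only [_root_.smul_apply, smul_eq_mul, nsmul_eq_mul, Nat.cast_ofNat,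
        show (2 : ℕ) - 1 = 1 from rfl, pow_one]
    refine integral_mono_of_nonneg (Eventually.of_forall fun φ => ?_)
      (by simp only [hQ]; exact hQi) (Eventually.of_forall fun φ => ?_)
    · exact mul_nonneg (by norm_num) (mul_nonneg (sum_sum_mul_mul_self_nonneg
        (D.posSemidef_Cdot 0 le_rfl) _) (inv_nonneg.2 (hε.le.trans (hab φ).1)))
    · simp only [hder, hQ]
      have hpos : 0 < f φ ^ 2 + ε := hε.trans_le (hab φ).1
      have hS := hQnn φ
      have heq : (1 / 4) * ((∑ k, ∑ l, D.Cdot 0 k l * (2 * f φ * fderiv ℝ f φ (EuclideanSpace.single k 1) *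
          (2 * f φ * fderiv ℝ f φ (EuclideanSpace.single l 1)))) * (f φ ^ 2 + ε)⁻¹) =
          (f φ ^ 2 / (f φ ^ 2 + ε)) * ∑ k, ∑ l, D.Cdot 0 k l *
            (fderiv ℝ f φ (EuclideanSpace.single k 1) * fderiv ℝ f φ (EuclideanSpace.single l 1)) := by
        simp only [Finset.mul_sum, Finset.sum_mul]
        refine Finset.sum_congr rfl fun k _ => Finset.sum_congr rfl fun l _ => ?_
        ring
      rw [heq]
      have hratio : f φ ^ 2 / (f φ ^ 2 + ε) ≤ 1 := by
        rw [div_le_one hpos]; linarith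
      calc f φ ^ 2 / (f φ ^ 2 + ε) * _ ≤ 1 * _ := mul_le_mul_of_nonneg_right hratio hS
        _ = _ := one_mul _
  ---------------------------------------------------------------- `ε ↓ 0`
  -- the entropy integrand converges, dominated by a constant
  obtain ⟨M, hM⟩ := isCompact_Icc.exists_bound_of_continuousOn
    (Real.continuous_mul_log.continuousOn (s := Icc (0 : ℝ) (Bf ^ 2 + 1)))
  have hA : Tendsto (fun ε : ℝ => ∫ φ, (f φ ^ 2 + ε) * Real.log (f φ ^ 2 + ε) ∂ν) (𝓝[>] 0)
      (𝓝 (∫ φ, f φ ^ 2 * Real.log (f φ ^ 2) ∂ν)) := by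
    refine tendsto_integral_filter_of_dominated_convergence (fun _ => M) ?_ ?_ (integrable_const M) ?_
    · exact Eventually.of_forall fun ε =>
        (Real.continuous_mul_log.comp ((hf.continuous.pow 2).add continuous_const)).aestronglyMeasurable
    · filter_upwards [Ioo_mem_nhdsGT one_pos] with ε hε
      exact Eventually.of_forall fun φ => hM _ ⟨by nlinarith [sq_nonneg (f φ), hε.1],
        by linarith [hf2le φ, hε.2]⟩
    · exact Eventually.of_forall fun φ => by
        have hc : Tendsto (fun ε : ℝ => f φ ^ 2 + ε) (𝓝[>] 0) (𝓝 (f φ ^ 2)) := by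
          have h : Tendsto (fun ε : ℝ => f φ ^ 2 + ε) (𝓝 0) (𝓝 (f φ ^ 2 + 0)) :=
            tendsto_const_nhds.add tendsto_id
          rw [add_zero] at h
          exact h.mono_left nhdsWithin_le_nhds
        exact (Real.continuous_mul_log.tendsto _).comp hc
  -- the mean converges
  have hf2i : Integrable (fun φ => f φ ^ 2) ν :=
    Integrable.of_bound ((hf.continuous.pow 2).aestronglyMeasurable) (Bf ^ 2)
      (Eventually.of_forall fun φ => by
        rw [Real.norm_eq_abs, abs_of_nonneg (sq_nonneg _)]; exact hf2le φ)
  have hmean : ∀ ε : ℝ, ∫ φ, (f φ ^ 2 + ε) ∂ν = (∫ φ, f φ ^ 2 ∂ν) + ε := fun ε => by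
    rw [integral_add hf2i (integrable_const ε), integral_const, probReal_univ, one_smul]
  have hB : Tendsto (fun ε : ℝ => (∫ φ, (f φ ^ 2 + ε) ∂ν) * Real.log (∫ φ, (f φ ^ 2 + ε) ∂ν))
      (𝓝[>] 0) (𝓝 ((∫ φ, f φ ^ 2 ∂ν) * Real.log (∫ φ, f φ ^ 2 ∂ν))) := by
    simp only [hmean]
    have hc : Tendsto (fun ε : ℝ => (∫ φ, f φ ^ 2 ∂ν) + ε) (𝓝[>] 0) (𝓝 (∫ φ, f φ ^ 2 ∂ν)) := by
      have h : Tendsto (fun ε : ℝ => (∫ φ, f φ ^ 2 ∂ν) + ε) (𝓝 0) (𝓝 ((∫ φ, f φ ^ 2 ∂ν) + 0)) :=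
        tendsto_const_nhds.add tendsto_id
      rw [add_zero] at h
      exact h.mono_left nhdsWithin_le_nhds
    exact (Real.continuous_mul_log.tendsto _).comp hc
  refine le_of_tendsto (hA.sub hB) ?_
  filter_upwards [self_mem_nhdsWithin] with ε hε
  exact hstep ε hε

end Main

end Polchinski

end Literature.Analysis.FunctionSpaces

end
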